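import Summits.AtomisticToContinuum.Crystallization.Theorems.OverbindingBudgetAffineRunCut
import Literature.MathematicalPhysics.StatisticalMechanics.TwoScaleShellSums
import Literature.MathematicalPhysics.StatisticalMechanics.SeparatedShellSums

/-!
(SPLIT FOR THE 400-LINE CAP by the landing lane, hand-2 g36: this file = part 1 of 3; sequels `…OverbindingBudgetAffineCompressedCutB`, `…OverbindingBudgetAffineCompressedCut` import it in a chain; same namespace, all FQNs unchanged.)
# NODE g79 «CompressedCut» — the compressed run-interior leaf RO through the PER-SITE SLACK of the floor identity

Route `OverbindingBudget` (Crystallization), crux `RobustDefectLimitWindows` (stmt-AtomisticToContinuum-31280), decomp-a2c lens 4 «minimal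
counterexample / extremal reduction», generation 79; critic row 1369 (viii): «RO typed-and-proved through the floor identity's per-site slack
(cheapest closable leaf; if the slack term is not uniform, report the obstruction — that itself re-tags RO)», caveat (iii): route the
compressed-site surplus through the SAME floor decomposition that proves `floor_le`, not a second sitewise localisation against `e⋆`.

TARGET.  `CompressedRun` («RO», tree `…OverbindingBudgetAffineRunCut(A)`): on every window `[δ, 2]`, `c > 0` per COMPRESSED rigid run-interior
interface cubic site (`(12, 10⁻⁴, 10⁻³)`-affinely deep, own spacing `< 17/20`) against `C·(#{not (64, 3/50)-deep} + #off + N^{2/3} + gains)`.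

§1  THE FLOOR IDENTITY WITH PER-SITE SLACK (PROVED, pure bookkeeping).  For ANY index class `P` (the priced sites) and ANY weight `w` with
    `w i k + w k i = 1` on `P`:  `𝓔(y) = ½·pairSum Pᶜ Pᶜ y + Σ_{i ∈ P} load P w y i`, `load P w y i = Σ_{k ∉ P} V(|yᵢ−y_k|) + Σ_{k ∈ P} w i k ·
    V(|yᵢ−y_k|)` (`interactionEnergy_eq_half_pairSum_compl_add_sum_load`), whence — by the tree's per-subset periodisation floor
    `card_mul_floor_le_half_pairSum` applied ONCE, to `Pᶜ` — `#Pᶜ·e⋆ + Σ_{i∈P} load P w y i ≤ 𝓔(y)` (`card_compl_mul_floor_add_sum_load_le`).  The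
    per-site SLACK of the identity at a priced site is `load − e⋆`; there is no second localisation and no cushion.
§2  THREE OBSTRUCTIONS MET ON THE WAY (memo NODE-g79 §3; each is a configuration family on which the naive sitewise slack is FALSE-type while RO
    stays TRUE-type) AND THE PRICING RULE THAT DISSOLVES ALL THREE.
    (O1) UNPRICED PULLER.  With `P` = the compressed run-interior sites only, an in-window `(64, 3/50)`-deep compressed sea at scale `≍ δ` that is
         neither priced nor rebated pulls a priced site at scale `a ≈ 17/20` by `≈ 1.1·10⁻⁵·a⁻³·δ⁻³ > 0.55` (the whole near-field slack) once
         `δ ≲ 1/30`: the slack is uniform in `N` but NOT in the window.  Cure: PRICE THE PULLER — every sound site compressed below a coarse threshold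
         `s₀` is priced too (any letter, any affine class), and a priced–priced pair is attributed to the SMALLER-SCALE site (`scaleWeight` = `0 / ½ / 1`
         by the ratio of own spacings, thresholds `2/5` and `5/2`), so finer priced matter never pulls a coarser priced site.  The threshold must
         satisfy `(2/5)·s₁ ≤ s₀` (then NO sound unpriced site is finer than `2/5` of the scale of any priced site: the harmful band is empty) and
         `s₀ ≲ 3/4` (the
         coarse-class near law: first-shell repulsion `6·V(1.06·s)` beats every attraction); we take `s₀ = 1/2`.
    (O2) STRIPPED FIRST SHELL.  If the pairs with BAD sites (not `64`-deep, or off-window) are charged globally in full, a priced site whose twelve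
         neighbours are made non-deep by junk placed just outside its own `64·nn`-ball keeps only its attractive outer shells: load `≈ −1.0 < e⋆`.
         Cure: the site load keeps the repulsive part `max V 0` of every bad pair; only the attractive part (`≥ −d⁻⁶/6`) is charged globally,
         `≤ (250/6)·δ⁻⁶` per bad site over the `δ`-separated priced class (Literature shell sum).  Declaring a neighbour bad then never lowers a load.
    (O3) NO SCALE COHERENCE IN DEEP BALLS (a trap, recorded as negative knowledge).  `(64, 3/50)`-deep registration does NOT bound the ratio of
         own spacings inside the ball: the Möbius image `x ↦ x/|x|²` of fcc is two-shell framed at `3/50` wherever `2·nn(x) ≤ 0.03·|x − pole|`, and a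
         deep ball `B(i, 64·nnᵢ)` with the pole at `1.2·64·nnᵢ` carries registered matter at every scale in `[nnᵢ/36, 3.4·nnᵢ]`.  The scheme
         therefore never invokes coherence beyond the FIRST SHELL ((F1′) below); scales enter only through `scaleWeight`, which is defined sitewise.
§3  THE TYPED PIECES.  `Sound`, `Priced` (two classes), `scaleWeight`, `siteLoad`; the sitewise law **`CompressedSiteSlack`** («PS»: `e⋆ + c ≤
    siteLoad(i)` at every priced site; STRONGER than RO, letter-free; TRUE-type with worst-case margin `0.575 − far ≈ 0.56` at `a = 17/20`
    (repulsive pairs at weight `½`, attractive at weight `1`, fcc and hcp alike; margin `0.85` at `a = 0.84`, `2.8` at `0.80`, `≈ 2·10³` at `1/2`) ·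
    ATTACKABLE-L); the census **`CompressedDeep`** («KD»: `c` per priced site against the SAME rebates; STRONGER than RO, WEAKER than PS); and
    beneath PS the near/far split at radius `R·nn_i`:  **`NearFieldSlack R κ`** («NS»: `e⋆ + c + κ·nn⁻⁶ ≤` the load from the `R·nn`-ball; node
    instance `(R, κ) = (12, 1/25)`; inputs = an EXPLICIT short affine development of the `(12, 10⁻⁴, 10⁻³)`-deep ball (NOT the record's
    hypothesis `hA : AffineChartStraightening` by name — its constant `C` is existential, so `hA` cannot be instantiated at the literal `(12, 10⁻⁴)`;
    the development's own constant need not be small, memo §5), ONE shell count for the annulus beyond the developed core, and (F1′) the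
    FIRST-SHELL SCALE FLOOR «a site at distance `≤ 1.06·nn_i` of a `3/50`-framed site `i` has own spacing `≥ 0.44·nn_i > (2/5)·nn_i`» (PROVED
    in the rider `…OverbindingBudgetAffineCompressedCutF1`: the `3/2`-exhaustive clause of `Framed` plus the unit separation of both patterns), so
    first-shell repulsion enters the load of `i` with weight `≥ ½`; TRUE-type with margin `≈ 0.575 − 0.106 (κ·nn⁻⁶) − 0.10 (annulus) − 0.05 (frame
    tolerance) ≈ 0.3` at `a = 17/20` · ATTACKABLE-M) ∧ **`FarFieldControl R κ`** («FC»: beyond `R·nn` every site pulling with non-zero weight has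
    own spacing `> (2/5)·nn` — finer priced matter has weight `0`, finer sound matter does not exist since `s₀ ≥ (2/5)·s₁`, bad matter enters through
    `max V 0 ≥ 0` — so the pull is a two-scale shell sum over a `(2/5)·nn`-separated class beyond `R·nn`: **PROVED** here, `farFieldControl_12 :
    FarFieldControl 12 (1/25)` from the sharp shell sum `sum_inv_pow_six_le_two_scale_sharp` (`K = 21`, shells of thickness `η` counted by the
    Literature's `card_le_of_separated_of_mem_shell`) and `farFieldControl_24 : FarFieldControl 24 (1/20)` from the Literature's `K = 250`).
§4  PROVED REDUCTIONS: `PS → KD` (`compressedDeep_of_siteSlack`: §1 with `P` = priced filter, `w = scaleWeight`), `KD → RO`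
    (`compressedRun_of_compressedDeep`: a compressed run site is priced, or not `64`-deep, or off-window; census domination `censusW_of_le_add`),
    `NS R κ → FC R κ → PS` (`compressedSiteSlack_of_near_far`), `FC R κ` from ANY two-scale bound `(λ, K)` with `R ≥ (2/5)λ`, `125 K ≤ 48 κ R³`
    (`farFieldControl_of_twoScale`, §4b), hence **`NearFieldSlack 12 (1/25) → CompressedRun`** (`compressedRun_of_nearFieldSlack`), and the record
    corollaries of `…AffineRunCut` with RO discharged to PS / to NS.

NODE g79:  RO ⟸ KD ⟸ PS ⟸ NS(12, 1/25)  [FC(12, 1/25) PROVED]  (all seams PROVED here; 0 sorry).  Pieces: KD «STRONGER·letter-free·TRUE-type»,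
PS «STRONGER·sitewise·TRUE-type (margin 0.56 at the class edge) · ATTACKABLE-L», NS «WEAKER-than-PS · TRUE-type (margin ≈ 0.3) · ATTACKABLE-M
(engine: an explicit short affine development — not `hA` by name — + lattice arithmetic + one annulus shell count + (F1′), PROVED in the rider)», FC «PROVED».  Why
novel: the lineage's first pricing scheme whose priced class is chosen by WHO PULLS rather than by who is being priced — two-class pricing, scale
attribution, repulsive parts of bad pairs kept sitewise — which is exactly what makes the floor identity's per-site slack uniform in the window,
the far half then closing by pure packing (no development, no letters, no coherence); and the negative finding (O3) that deep registration carries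
no mesoscopic scale coherence (Möbius-inverted lattices), which redirects every future far-field argument of the lineage to scale-attributed weights.
Why each piece is strictly weaker / honestly stronger: KD and PS price a SUPERSET of RO's class with the same rebates (stronger, by design —
strengthen-to-prove); NS is PS minus its proved far half and does not bound the load alone.

Deps (tree only): `…OverbindingBudgetAffineRunCut` (+ its cone: `CensusW`, `pairSum`, `card_mul_floor_le_half_pairSum`, `DeepReg`, `AffDeepReg`,
`InWindow`, `offCount`, `notDeepCount`, `e0`, Literature `sum_inv_pow_six_le`, `neg_le_lennardJones_of_le`, `lennardJones_zero`), Literature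
`TwoScaleShellSums` (`sum_inv_pow_six_le_two_scale`) and `SeparatedShellSums` (`card_le_of_separated_of_mem_shell`).  No `instance`, no `notation`,
no new axioms; restates nothing (RO is consumed BY NAME).
-/

namespace Summit.AtomisticToContinuum.Crystallization.Theorems.OverbindingBudgetAffineCompressedCut

open scoped BigOperators Classical
open Literature.MathematicalPhysics.StatisticalMechanics
open Literature.Geometry.DiscreteGeometry (IsChargeFree nearestDist nearestDist_nonneg nearestDist_le_dist)
open Summit.AtomisticToContinuum.Crystallization.Theorems.OverbindingBudgetMisfitRegistration (Framed Reg DeepReg)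
open Summit.AtomisticToContinuum.Crystallization.Theorems.OverbindingBudgetMisfitWindowStatements (InWindow offCount)
open Summit.AtomisticToContinuum.Crystallization.Theorems.OverbindingBudgetBalancedCensusStatements
open Summit.AtomisticToContinuum.Crystallization.Theorems.OverbindingBudgetAffineLadder
open Summit.AtomisticToContinuum.Crystallization.Theorems.OverbindingBudgetAffineLocalisation (pairSum two_mul_interactionEnergy_eq_pairSum
  pairSum_univ_left pairSum_univ_right card_mul_floor_le_half_pairSum)
open Summit.AtomisticToContinuum.Crystallization.Theorems.OverbindingBudgetAffineMesoCut
open Summit.AtomisticToContinuum.Crystallization.Theorems.OverbindingBudgetAffinePhaseCut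
open Summit.AtomisticToContinuum.Crystallization.Theorems.OverbindingBudgetAffineCushionCut
open Summit.AtomisticToContinuum.Crystallization.Theorems.OverbindingBudgetAffineTwinCut
open Summit.AtomisticToContinuum.Crystallization.Theorems.OverbindingBudgetAffineRunCut

variable {N : ℕ}

/-! ## §1  The floor identity with per-site slack (PROVED, any potential-free bookkeeping) -/

/-- The LOAD of the site `i` relative to a priced class `P` and a weight `w`: the full pair energy with every unpriced site plus the
`w i k`-weighted pair energy with every priced site (the diagonal contributes `w i i · V(0) = 0`). -/
noncomputable def load (P : Finset (Fin N)) (w : Fin N → Fin N → ℝ) (y : Fin N → EuclideanSpace ℝ (Fin 3)) (i : Fin N) : ℝ :=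
  ∑ k ∈ Pᶜ, lennardJones (dist (y i) (y k)) + ∑ k ∈ P, w i k * lennardJones (dist (y i) (y k))

/-- `pairSum` is symmetric in its two classes (`dist` is symmetric). [formal bookkeeping] -/
theorem pairSum_comm (S T : Finset (Fin N)) (y : Fin N → EuclideanSpace ℝ (Fin 3)) : pairSum S T y = pairSum T S y := by
  unfold pairSum
  rw [Finset.sum_comm]
  exact Finset.sum_congr rfl fun i _ => Finset.sum_congr rfl fun j _ => by rw [dist_comm]

/-- A weight splitting `1` over ordered pairs halves the class self-energy: `pairSum P P y = 2 · Σ_{i∈P} Σ_{k∈P} w i k · V_{ik}`.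
[formal bookkeeping] -/
theorem pairSum_eq_two_mul_sum_weight (P : Finset (Fin N)) {w : Fin N → Fin N → ℝ}
    (hw : ∀ i ∈ P, ∀ k ∈ P, i ≠ k → w i k + w k i = 1) (y : Fin N → EuclideanSpace ℝ (Fin 3)) :
    pairSum P P y = 2 * ∑ i ∈ P, ∑ k ∈ P, w i k * lennardJones (dist (y i) (y k)) := by
  have h1 : pairSum P P y = ∑ i ∈ P, ∑ k ∈ P, (w i k + w k i) * lennardJones (dist (y i) (y k)) := by
    unfold pairSum
    refine Finset.sum_congr rfl fun i hi => Finset.sum_congr rfl fun k hk => ?_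
    by_cases hik : i = k
    · subst hik
      simp [lennardJones_zero]
    · rw [hw i hi k hk hik, one_mul]
  have h2 : ∑ i ∈ P, ∑ k ∈ P, w k i * lennardJones (dist (y i) (y k)) = ∑ i ∈ P, ∑ k ∈ P, w i k * lennardJones (dist (y i) (y k)) := by
    rw [Finset.sum_comm]
    exact Finset.sum_congr rfl fun i _ => Finset.sum_congr rfl fun k _ => by rw [dist_comm]
  rw [h1]
  have h3 : ∑ i ∈ P, ∑ k ∈ P, (w i k + w k i) * lennardJones (dist (y i) (y k)) =
      ∑ i ∈ P, ∑ k ∈ P, w i k * lennardJones (dist (y i) (y k)) + ∑ i ∈ P, ∑ k ∈ P, w k i * lennardJones (dist (y i) (y k)) := by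
    rw [← Finset.sum_add_distrib]
    refine Finset.sum_congr rfl fun i _ => ?_
    rw [← Finset.sum_add_distrib]
    exact Finset.sum_congr rfl fun k _ => by ring
  rw [h3, h2]
  ring

/-- **THE FLOOR IDENTITY WITH PER-SITE SLACK**: `𝓔(y) = ½·pairSum Pᶜ Pᶜ y + Σ_{i∈P} load P w y i` for every class `P` and every weight
splitting `1` over priced pairs. [this file] -/
theorem interactionEnergy_eq_half_pairSum_compl_add_sum_load (P : Finset (Fin N)) {w : Fin N → Fin N → ℝ}
    (hw : ∀ i ∈ P, ∀ k ∈ P, i ≠ k → w i k + w k i = 1) (y : Fin N → EuclideanSpace ℝ (Fin 3)) :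
    interactionEnergy lennardJones y = 1 / 2 * pairSum Pᶜ Pᶜ y + ∑ i ∈ P, load P w y i := by
  have h2 := two_mul_interactionEnergy_eq_pairSum y
  rw [pairSum_univ_left P, pairSum_univ_right P P, pairSum_univ_right Pᶜ P, pairSum_comm Pᶜ P,
    pairSum_eq_two_mul_sum_weight P hw] at h2
  have hload : ∑ i ∈ P, load P w y i = pairSum P Pᶜ y + ∑ i ∈ P, ∑ k ∈ P, w i k * lennardJones (dist (y i) (y k)) := by
    unfold load pairSum
    rw [Finset.sum_add_distrib]
  rw [hload]
  linarith

/-- **THE FLOOR WITH PER-SITE SLACK**: `#Pᶜ·e⋆ + Σ_{i∈P} load P w y i ≤ 𝓔(y)` — the tree's per-subset periodisation floor applied ONCE, to the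
unpriced class. [this file; `card_mul_floor_le_half_pairSum`] -/
theorem card_compl_mul_floor_add_sum_load_le {y : Fin N → EuclideanSpace ℝ (Fin 3)} (hy : Function.Injective y) (P : Finset (Fin N))
    {w : Fin N → Fin N → ℝ} (hw : ∀ i ∈ P, ∀ k ∈ P, i ≠ k → w i k + w k i = 1) :
    (Pᶜ.card : ℝ) * (⨅ Q : PeriodicConfiguration 3, Q.energyPerParticle lennardJones) + ∑ i ∈ P, load P w y i
      ≤ interactionEnergy lennardJones y := by
  rw [interactionEnergy_eq_half_pairSum_compl_add_sum_load P hw y]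
  linarith [card_mul_floor_le_half_pairSum hy Pᶜ]

/-! ## §2  Two-class pricing and scale attribution -/

/-- `Sound ρ ε g δ y k`: `(ρ, ε)`-deeply registered AND in the window `[δ, 2]` — the sites that are neither rebated as not-deep nor as off-window. -/
def Sound (ρ ε g δ : ℝ) (y : Fin N → EuclideanSpace ℝ (Fin 3)) (k : Fin N) : Prop :=
  DeepReg ρ ε g y k ∧ InWindow δ 2 y k

/-- **`Priced ρ ρ₁ η θ₀ s₀ s₁ ε g δ y i`** — the TWO-CLASS priced set: a sound site that is EITHER compressed below the coarse threshold
(`nn_i < s₀`, any letter, any affine class) OR compressed in the affine class (`(ρ₁, η, θ₀)`-affinely deep and `nn_i < s₁`).  The node takes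
`s₀ = 1/2 ≥ (2/5)·s₁` so that no sound unpriced site is finer than `2/5` of the scale of a priced one (O1). -/
def Priced (ρ ρ₁ η θ₀ s₀ s₁ ε g δ : ℝ) (y : Fin N → EuclideanSpace ℝ (Fin 3)) (i : Fin N) : Prop :=
  Sound ρ ε g δ y i ∧ (nearestDist y i < s₀ ∨ (AffDeepReg ρ₁ η θ₀ g y i ∧ nearestDist y i < s₁))

/-- The priced count. -/
noncomputable def pricedCount (ρ ρ₁ η θ₀ s₀ s₁ ε g δ : ℝ) (y : Fin N → EuclideanSpace ℝ (Fin 3)) : ℕ :=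
  Nat.card {i : Fin N // Priced ρ ρ₁ η θ₀ s₀ s₁ ε g δ y i}

/-- A priced site has positive own spacing (`0 < δ ≤ nn`). [this file] -/
theorem nearestDist_pos_of_priced {ρ ρ₁ η θ₀ s₀ s₁ ε g δ : ℝ} (hδ : 0 < δ) {y : Fin N → EuclideanSpace ℝ (Fin 3)} {i : Fin N}
    (hi : Priced ρ ρ₁ η θ₀ s₀ s₁ ε g δ y i) : 0 < nearestDist y i :=
  hδ.trans_le hi.1.2.1

/-- Priced sites keep distance `≥ δ` from every other site. [this file] -/
theorem le_dist_of_priced {ρ ρ₁ η θ₀ s₀ s₁ ε g δ : ℝ} {y : Fin N → EuclideanSpace ℝ (Fin 3)} {i j : Fin N}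
    (hi : Priced ρ ρ₁ η θ₀ s₀ s₁ ε g δ y i) (hij : i ≠ j) : δ ≤ dist (y i) (y j) :=
  hi.1.2.1.trans (nearestDist_le_dist y hij.symm)

/-- **SCALE ATTRIBUTION**: the share of the pair `{i, k}` carried by `i` — `0` if `k` lives at most at `2/5` of the scale of `i` (the pair is
`k`'s), `1` if `k` lives at least at `5/2` times the scale of `i` (the pair is `i`'s), `½` at comparable scales.  (Ratio `5/2` rather than `2`:
a site in the first shell of a `3/50`-framed site `i` has own spacing `≥ 0.44·nn_i > (2/5)·nn_i` by the exhaustive clause of `Framed` alone —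
(F1′) of the header — so first-shell repulsion is never attributed away from `i`.) -/
noncomputable def scaleWeight (y : Fin N → EuclideanSpace ℝ (Fin 3)) (i k : Fin N) : ℝ :=
  if nearestDist y k ≤ 2 / 5 * nearestDist y i then 0 else if 5 / 2 * nearestDist y i ≤ nearestDist y k then 1 else 1 / 2

/-- The shares of an ordered pair and of its reverse add up to `1` (the positivity of one of the two scales suffices). [this file] -/
theorem scaleWeight_add_scaleWeight {y : Fin N → EuclideanSpace ℝ (Fin 3)} (i : Fin N) {k : Fin N} (hk : 0 < nearestDist y k) :
    scaleWeight y i k + scaleWeight y k i = 1 := by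
  unfold scaleWeight
  split_ifs <;> first | (exfalso; linarith) | norm_num

/-- `0 ≤ scaleWeight ≤ 1`. [this file] -/
theorem scaleWeight_nonneg (y : Fin N → EuclideanSpace ℝ (Fin 3)) (i k : Fin N) : 0 ≤ scaleWeight y i k := by
  unfold scaleWeight; split_ifs <;> norm_num

/-- `scaleWeight_le_one` (docstring added by the landing lane; see the module docstring). [formal bookkeeping] -/
theorem scaleWeight_le_one (y : Fin N → EuclideanSpace ℝ (Fin 3)) (i k : Fin N) : scaleWeight y i k ≤ 1 := by
  unfold scaleWeight; split_ifs <;> norm_num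

/-- **The SITE LOAD of a priced site** — the quantity the sitewise law bounds below: the scale-attributed pair energy with the priced sites, the
full pair energy with the sound unpriced sites, and the REPULSIVE PART `max V 0` of the pair energy with the bad sites (not deep or off-window; the
attractive part of a bad pair, `≥ −d⁻⁶/6`, is charged globally to the bad site).  Declaring a neighbour bad therefore never lowers the load. -/
noncomputable def siteLoad (ρ ρ₁ η θ₀ s₀ s₁ ε g δ : ℝ) (y : Fin N → EuclideanSpace ℝ (Fin 3)) (i : Fin N) : ℝ :=
  ∑ k ∈ Finset.univ.filter (fun k => Priced ρ ρ₁ η θ₀ s₀ s₁ ε g δ y k), scaleWeight y i k * lennardJones (dist (y i) (y k))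
    + ∑ k ∈ Finset.univ.filter (fun k => Sound ρ ε g δ y k ∧ ¬ Priced ρ ρ₁ η θ₀ s₀ s₁ ε g δ y k), lennardJones (dist (y i) (y k))
    + ∑ k ∈ Finset.univ.filter (fun k => ¬ Sound ρ ε g δ y k), max (lennardJones (dist (y i) (y k))) 0

/-! ## §3  The typed pieces -/

/-- **`CompressedSiteSlackAt … δ`** — the sitewise law on the window `[δ, 2]`: some `c > 0` with `e⋆ + c ≤ siteLoad(i)` at every priced site of
every injective configuration. -/
def CompressedSiteSlackAt (ρ ρ₁ η θ₀ s₀ s₁ ε g δ : ℝ) : Prop :=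
  ∃ c : ℝ, 0 < c ∧ ∀ (N : ℕ) (y : Fin N → EuclideanSpace ℝ (Fin 3)), Function.Injective y → ∀ i : Fin N,
    Priced ρ ρ₁ η θ₀ s₀ s₁ ε g δ y i → (⨅ Q : PeriodicConfiguration 3, Q.energyPerParticle lennardJones) + c ≤ siteLoad ρ ρ₁ η θ₀ s₀ s₁ ε g δ y i

/-- **`CompressedSiteSlack`** («PS») at the node's parameters `(64, 12, 10⁻⁴, 10⁻³, s₀ = 1/2, s₁ = 17/20, 3/50, 1/450)`, all windows.
[this file · kind: statement · STRONGER than RO (sitewise, letter-free) · TRUE-type (memo §4: worst-case margin `0.575` at `nn = 17/20` before the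
far debit `≈ 0.012`, fcc and hcp alike; obstructions (O1)–(O3) of the header do not bite this form) · ATTACKABLE-L · split beneath:
`NearFieldSlack R κ ∧ FarFieldControl R κ` with `FarFieldControl 12 (1/25)` PROVED (§4b), so the open leaf is `NearFieldSlack 12 (1/25)`] -/
def CompressedSiteSlack : Prop :=
  ∀ δ : ℝ, 0 < δ → δ ≤ 2 → CompressedSiteSlackAt 64 12 (1 / 10 ^ 4) (1 / 1000) (1 / 2) (17 / 20) (3 / 50) (1 / 450) δ

/-- **`CompressedDeepAt … δ`** — the two-class census on the window `[δ, 2]`: `CensusW` of the priced count against the not-deep rebate. -/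
def CompressedDeepAt (ρ ρ₁ η θ₀ s₀ s₁ ε g δ : ℝ) : Prop :=
  CensusW (fun y => pricedCount ρ ρ₁ η θ₀ s₀ s₁ ε g δ y) (fun y => notDeepCount ρ ε g y) δ 2

/-- **`CompressedDeep`** («KD») at the node's parameters, all windows: `c > 0` per sound site compressed in the affine class or below `1/2`,
against `C·(#{not 64-deep} + #off + N^{2/3} + gains)`. [this file · kind: statement · STRONGER than RO, WEAKER than PS · letter-free · TRUE-type] -/
def CompressedDeep : Prop :=
  ∀ δ : ℝ, 0 < δ → δ ≤ 2 → CompressedDeepAt 64 12 (1 / 10 ^ 4) (1 / 1000) (1 / 2) (17 / 20) (3 / 50) (1 / 450) δ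

/-- The site load NEAR part: terms with `dist (y i) (y k) ≤ R · nn_i`. -/
noncomputable def nearLoad (ρ ρ₁ η θ₀ s₀ s₁ ε g δ R : ℝ) (y : Fin N → EuclideanSpace ℝ (Fin 3)) (i : Fin N) : ℝ :=
  ∑ k ∈ Finset.univ.filter (fun k => Priced ρ ρ₁ η θ₀ s₀ s₁ ε g δ y k ∧ dist (y i) (y k) ≤ R * nearestDist y i),
      scaleWeight y i k * lennardJones (dist (y i) (y k))
    + ∑ k ∈ Finset.univ.filter (fun k => (Sound ρ ε g δ y k ∧ ¬ Priced ρ ρ₁ η θ₀ s₀ s₁ ε g δ y k) ∧ dist (y i) (y k) ≤ R * nearestDist y i),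
      lennardJones (dist (y i) (y k))
    + ∑ k ∈ Finset.univ.filter (fun k => ¬ Sound ρ ε g δ y k ∧ dist (y i) (y k) ≤ R * nearestDist y i),
      max (lennardJones (dist (y i) (y k))) 0

/-- The site load FAR part: terms with `dist (y i) (y k) > R · nn_i`. -/
noncomputable def farLoad (ρ ρ₁ η θ₀ s₀ s₁ ε g δ R : ℝ) (y : Fin N → EuclideanSpace ℝ (Fin 3)) (i : Fin N) : ℝ :=
  ∑ k ∈ Finset.univ.filter (fun k => Priced ρ ρ₁ η θ₀ s₀ s₁ ε g δ y k ∧ ¬ dist (y i) (y k) ≤ R * nearestDist y i),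
      scaleWeight y i k * lennardJones (dist (y i) (y k))
    + ∑ k ∈ Finset.univ.filter (fun k => (Sound ρ ε g δ y k ∧ ¬ Priced ρ ρ₁ η θ₀ s₀ s₁ ε g δ y k) ∧ ¬ dist (y i) (y k) ≤ R * nearestDist y i),
      lennardJones (dist (y i) (y k))
    + ∑ k ∈ Finset.univ.filter (fun k => ¬ Sound ρ ε g δ y k ∧ ¬ dist (y i) (y k) ≤ R * nearestDist y i),
      max (lennardJones (dist (y i) (y k))) 0

/-- `siteLoad = nearLoad R + farLoad R`. [formal bookkeeping] -/
theorem siteLoad_eq_nearLoad_add_farLoad (ρ ρ₁ η θ₀ s₀ s₁ ε g δ R : ℝ) (y : Fin N → EuclideanSpace ℝ (Fin 3)) (i : Fin N) :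
    siteLoad ρ ρ₁ η θ₀ s₀ s₁ ε g δ y i = nearLoad ρ ρ₁ η θ₀ s₀ s₁ ε g δ R y i + farLoad ρ ρ₁ η θ₀ s₀ s₁ ε g δ R y i := by
  unfold siteLoad nearLoad farLoad
  rw [← Finset.sum_filter_add_sum_filter_not (Finset.univ.filter fun k => Priced ρ ρ₁ η θ₀ s₀ s₁ ε g δ y k)
      (fun k => dist (y i) (y k) ≤ R * nearestDist y i),
    ← Finset.sum_filter_add_sum_filter_not (Finset.univ.filter fun k => Sound ρ ε g δ y k ∧ ¬ Priced ρ ρ₁ η θ₀ s₀ s₁ ε g δ y k)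
      (fun k => dist (y i) (y k) ≤ R * nearestDist y i),
    ← Finset.sum_filter_add_sum_filter_not (Finset.univ.filter fun k => ¬ Sound ρ ε g δ y k)
      (fun k => dist (y i) (y k) ≤ R * nearestDist y i)]
  simp only [Finset.filter_filter]
  ring

/-- **`NearFieldSlackAt … δ R κ`** — the NEAR-FIELD law: `e⋆ + c + κ·nn_i⁻⁶ ≤ nearLoad R (i)` at every priced site (affine-lattice sums on the
`R·nn`-ball with first-shell repulsive pairs at weight `≥ ½` — the first-shell scale floor (F1′) — and attractive pairs at weight `≤ 1`). -/
def NearFieldSlackAt (ρ ρ₁ η θ₀ s₀ s₁ ε g δ R κ : ℝ) : Prop :=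
  ∃ c : ℝ, 0 < c ∧ ∀ (N : ℕ) (y : Fin N → EuclideanSpace ℝ (Fin 3)), Function.Injective y → ∀ i : Fin N,
    Priced ρ ρ₁ η θ₀ s₀ s₁ ε g δ y i →
      (⨅ Q : PeriodicConfiguration 3, Q.energyPerParticle lennardJones) + c + κ * (nearestDist y i)⁻¹ ^ 6 ≤ nearLoad ρ ρ₁ η θ₀ s₀ s₁ ε g δ R y i

/-- **`FarFieldControlAt … δ R κ`** — the FAR-FIELD law: the scale-attributed far load costs at most `κ·nn_i⁻⁶` at every priced site (beyond
`R·nn` every site pulling with non-zero weight has own spacing `> (2/5)·nn_i`, so the pull is a two-scale shell sum over a `(2/5)·nn_i`-separated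
class; bad sites enter through `max V 0 ≥ 0`; NO scale coherence of deep balls is used — there is none, (O3)).  PROVED in §4b. -/
def FarFieldControlAt (ρ ρ₁ η θ₀ s₀ s₁ ε g δ R κ : ℝ) : Prop :=
  ∀ (N : ℕ) (y : Fin N → EuclideanSpace ℝ (Fin 3)), Function.Injective y → ∀ i : Fin N,
    Priced ρ ρ₁ η θ₀ s₀ s₁ ε g δ y i → -(κ * (nearestDist y i)⁻¹ ^ 6) ≤ farLoad ρ ρ₁ η θ₀ s₀ s₁ ε g δ R y i

/-- **`NearFieldSlack R κ`** («NS») at the node's parameters, all windows — THE OPEN LEAF at `(R, κ) = (12, 1/25)`. [this file · kind: statement ·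
WEAKER than PS · TRUE-type at `(12, 1/25)` (margin `≈ 0.575 − 0.106 (κ·(20/17)⁶) − 0.10 (annulus beyond the developed core, shell counting) − 0.05 (frame
tolerance + development) ≈ 0.3` at `a = 17/20`, memo §4–§5) given an EXPLICIT short affine development of the `(12, 10⁻⁴, 10⁻³)`-deep ball (not the record's
`hA : AffineChartStraightening` by name: its constant is existential) and the first-shell scale floor (F1′), PROVED in the rider `…CompressedCutF1` · ATTACKABLE-M] -/
def NearFieldSlack (R κ : ℝ) : Prop :=
  ∀ δ : ℝ, 0 < δ → δ ≤ 2 → NearFieldSlackAt 64 12 (1 / 10 ^ 4) (1 / 1000) (1 / 2) (17 / 20) (3 / 50) (1 / 450) δ R κ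

/-- **`FarFieldControl R κ`** («FC») at the node's parameters, all windows. [this file · kind: statement · WEAKER than PS · **PROVED** at
`(12, 1/25)` (`farFieldControl_12`, sharp two-scale shell sum `K = 21`) and at `(24, 1/20)` (`farFieldControl_24`, Literature `K = 250`), §4b] -/
def FarFieldControl (R κ : ℝ) : Prop :=
  ∀ δ : ℝ, 0 < δ → δ ≤ 2 → FarFieldControlAt 64 12 (1 / 10 ^ 4) (1 / 1000) (1 / 2) (17 / 20) (3 / 50) (1 / 450) δ R κ

/-! ## §4  PROVED: `NS ∧ FC → PS` -/

/-- Near slack plus far control give the sitewise law, window by window. [this file] -/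
theorem compressedSiteSlackAt_of_near_far {ρ ρ₁ η θ₀ s₀ s₁ ε g δ R κ : ℝ} (hN : NearFieldSlackAt ρ ρ₁ η θ₀ s₀ s₁ ε g δ R κ)
    (hF : FarFieldControlAt ρ ρ₁ η θ₀ s₀ s₁ ε g δ R κ) : CompressedSiteSlackAt ρ ρ₁ η θ₀ s₀ s₁ ε g δ := by
  obtain ⟨c, hc, hN⟩ := hN
  refine ⟨c, hc, fun N y hy i hi => ?_⟩
  have h1 := hN N y hy i hi
  have h2 := hF N y hy i hi
  rw [siteLoad_eq_nearLoad_add_farLoad ρ ρ₁ η θ₀ s₀ s₁ ε g δ R y i]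
  linarith

/-- **`NearFieldSlack R κ → FarFieldControl R κ → CompressedSiteSlack`.** [this file] -/
theorem compressedSiteSlack_of_near_far {R κ : ℝ} (hN : NearFieldSlack R κ) (hF : FarFieldControl R κ) : CompressedSiteSlack :=
  fun δ hδ hδ2 => compressedSiteSlackAt_of_near_far (hN δ hδ hδ2) (hF δ hδ hδ2)

end Summit.AtomisticToContinuum.Crystallization.Theorems.OverbindingBudgetAffineCompressedCut
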